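import Literature.AlgebraicGeometry.Milne1999.LefschetzGroupProducts
import HarnessLib

/-!
# `C(A^r) = C(A)` diagonally (Milne 1999, Duke 96, §1 p. 643 — powers, `ℂ`-points, read on `H¹`)

Family `hodge`, layer `Literature/AlgebraicGeometry/Milne1999`, namespace
`Literature.AlgebraicGeometry.Milne1999` (D-0022).  Sequel of `Milne1999/LefschetzCentraliserProducts`
(`C(A × B) ⊂ C(A) × C(B)`, equality iff `Hom(A, B) = 0 = Hom(B, A)`; block maps `prodBlockDiag`,
`prodRestrictFst/Snd` on `H¹(A × B) = pr_A^* H¹(A) ⊕ pr_B^* H¹(B)`) and `Milne1999/LefschetzGroupProducts`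
(the product polarization `prodPolarizationClass` and the block form of its pairing), both of which list
"Powers (`A → ∏ Aᵢ^{rᵢ}`, Milne: 'by induction'; `C(A^r) = C(A)` diagonally)" under "What is NOT here".
Written for the cell `pub-hodgecm2` (COR-CM), seat `lit-milne`, as the centraliser-side input of the
`r ≥ 2` half of Milne's Theorem 4.4 (the cited record
`Milne1999_thm44_specialLefschetzGroup_one_eq_unitaryCentralizerGroup` of `Milne1999/LefschetzCentraliser`;
its `⊆` half and the `r = 1` case of `⊇` are the theorems of `LefschetzGroupCentraliserInclusion` /
`CentraliserFixesDivisorClasses`).  No named fact is introduced (D-0026); the two `def`s (`diagPow`,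
`powPolarizationClass`) are recursions with bodies.

## Source read (held text `paper:doi-10-1215-s0012-7094-99-09620-5` = J. S. Milne, *Lefschetz classes on abelian varieties*, Duke Math. J. 96 (1999) 639–675), verbatim

* §1, p. 643 [corpus: paper:doi-10-1215-s0012-7094-99-09620-5 p0005 L12–L16]: "For any positive
  integer `r`, `V(A^r) = rV(A)`, and the diagonal action of `C(A)` on `rV(A)` identifies `C(A)` with
  `C(A^r)` (as `k`-algebras with involution). Let `A = A₁ × ⋯ × A_s`. Then
  `C(A) ⊂ C(A₁) × ⋯ × C(A_s)`, with equality holding if and only if `Hom(Aᵢ, Aⱼ) = 0` for all `i, j`,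
  `i ≠ j`. Moreover, if `Dᵢ` is an ample divisor on `Aᵢ`, `i = 1, …, s`, then
  `D = Σᵢ A₁ × ⋯ × A_{i-1} × Dᵢ × A_{i+1} × ⋯ × A_s` is an ample divisor on `A`, and the involution it
  defines on `C(A)` is the restriction of the product of the involutions on the `C(Aᵢ)` defined by
  the `Dᵢ`."
* §1, p. 644 [ibid. p0006 L19–L22]: "`S(A)(R) = {γ ∈ C(A) ⊗_k R | γ†γ = 1}` […] for any ample divisor
  `D` on `A`, `S(A)` is the largest algebraic subgroup of `Sp(e_D)` whose elements commute with the
  endomorphisms of `A`."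
* §4, p. 659 [ibid. p0021 L16–L20], proof of Thm. 4.4: "For any `γ ∈ G(A)(k)` and divisor `D` on `A`,
  `e_D(γx, γy) = e_D(x, γ†γx) = γ†γ · e_D(x, y)` […] More generally, any `γ ∈ G(A)(k^al)` will fix all
  divisor classes on `A^r`, all `r`."  (It is through the diagonal action on `V(A^r) = rV(A)` that
  `γ ∈ G(A)` acts on `A^r`; this file supplies that action on the tree's carriers.)

## Lean rendering (the tree's carriers; `ℂ`-points; everything read on `H¹`)

Powers are the tree's `A.powSucc a = A^{a+1}` (`A^{a+2} = A^{a+1} × A`, `Motives/SupersingularAbelianVariety`;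
underlying scheme `= cartesianPow A.X (a + 1)`, `AbelianVariety.powSucc_X_eq_cartesianPow`).  As in the two
product files, `C(A) ⊗ ℂ` acts on `H¹(A(ℂ); ℂ) = complexBetti A.X 1 = V(A)^∨ ⊗ ℂ`, `C(A)^× ⊗ ℂ` is
`centralizerGroup A`, `S(A)(ℂ) = unitaryCentralizerGroup A h`, `G(A)(ℂ) = similitudeCentralizerGroup A h`.

* §1 `map_map_fst_one_eq_add`, `map_map_snd_one_eq_add` — the FOUR BLOCKS of `χ^*` for an arbitrary
  `χ ∈ End(B × C)` ("`End(A × B)` as `2 × 2` matrices"): `χ^* pr_B^* b = pr_B^* χ_BB^* b + pr_C^* χ_CB^* b`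
  with `χ_BB = (𝟙,0) ≫ χ ≫ pr_B ∈ End(B)`, `χ_CB = (0,𝟙) ≫ χ ≫ pr_B ∈ Hom(C, B)`, and symmetrically.
* §2 `prodBlockDiag_apply_map_of_intertwine`, **`prodBlockDiagEquiv_mem_centralizerGroup_of_intertwine`** —
  the general criterion behind Milne's product paragraph: `s ⊕ t ∈ C(B × C)` as soon as `s ∈ C(B)`,
  `t ∈ C(C)`, AND `s`, `t` intertwine the off-diagonal blocks: `t (g^* b) = g^* (s b)` for every
  `g ∈ Hom(C, B)` and `s (f^* c) = f^* (t c)` for every `f ∈ Hom(B, C)` (for `Hom = 0` this is the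
  criterion `prodBlockDiagEquiv_mem_centralizerGroup` of `LefschetzCentraliserProducts`; for `C = B`,
  `s = t` it is the diagonal case); and conversely (`prodBlockDiagEquiv_mem_centralizerGroup_iff`, testing
  against the endomorphisms `pr_C ≫ g ≫ (𝟙, 0)`, `pr_B ≫ f ≫ (0, 𝟙)`).
* §3 `diagPow A u a` — **the diagonal action `u ↦ u^{⊕(a+1)}` of `GL(H¹(A))` on `H¹(A^{a+1}) = (a+1) H¹(A)`**
  (recursion `u^{⊕(a+2)} = u^{⊕(a+1)} ⊕ u` along `A^{a+2} = A^{a+1} × A`); `powPolarizationClass A h a` —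
  the class `Σᵢ prᵢ^* h` of Milne's divisor `D = Σᵢ A × ⋯ × Dᵢ × ⋯ × A` on `A^{a+1}` (recursion through
  `prodPolarizationClass`); `diagPow_one`, `diagPow_mul` (the action is a homomorphism),
  `prodRestrictSnd_diagPow_succ` (its last block is `u`: the action is faithful).
* §4 **`diagPow_mem_centralizerGroup`** — `u ∈ C(A) ⟹ u^{⊕(a+1)} ∈ C(A^{a+1})` ("the diagonal action of
  `C(A)` on `rV(A)` [lands in] `C(A^r)`"), proved together with the intertwining relations
  `u ∘ g^* = g^* ∘ u^{⊕(a+1)}` (`g ∈ Hom(A, A^{a+1})`) and `u^{⊕(a+1)} ∘ f^* = f^* ∘ u` (`f ∈ Hom(A^{a+1}, A)`)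
  that drive the induction (`diagPow_intertwine_left/right`); **`exists_eq_diagPow_of_mem_centralizerGroup`**
  — "identifies": every element of `C(A^{a+1})` IS diagonal; `centralizerGroup.diagPowHom`,
  **`centralizerGroup.diagPowMulEquiv : C(A) ≃* C(A^{a+1})`**.
* §5 **`diagPow_mem_unitaryCentralizerGroup`** — "as `k`-algebras with involution": for `0 < dim A` and
  `u ∈ S(A)(ℂ)` (for the class `h`), `u^{⊕(a+1)} ∈ S(A^{a+1})(ℂ)` for the product class `Σᵢ prᵢ^* h`
  (the block form of `Q_D`, `polarizationPairingOne_prod_apply_apply_eq_smul`); the same with a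
  multiplier, `polarizationPairingOne_diagPow_eq_smul` / `diagPow_mem_similitudeCentralizerGroup`
  (`G(A) → G(A^{a+1})`, same multiplier `γ†γ`).

## What is NOT here

* The `k`-structure (everything is on `ℂ`-points); the surjectivity of `S(A) → S(A^{a+1})` (it needs the
  non-degeneracy `(Σᵢ prᵢ^* h)^{dim} ≠ 0`, cf. `mem_unitaryCentralizerGroup_prod_iff`); Thm. 4.4 itself (the
  Künneth family `⋀•(u^{⊕(a+1)})` on the cohomology of the powers and the divisor classes of `A^{a+1}` are
  the remaining inputs of its `r ≥ 2` half, see `CentraliserFixesDivisorClasses` for `r = 1`).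

## References

* [Milne1999LefschetzClasses] J. S. Milne, Lefschetz classes on abelian varieties, Duke Math. J. 96
  (1999) 639–675: §1 pp. 643–644 (powers and products of `C(A)`, `S(A)`), §4 p. 659 (proof of Thm. 4.4).
* [LangeBirkenhake1992] Ch. Birkenhake, H. Lange, Complex Abelian Varieties (1992), §1.1 (p. 19), §5.3.
* [HatcherAT2002] A. Hatcher, Algebraic Topology (2002), §3.2 Thm. 3.16 (Künneth in degree one).
* [Kieffer2024IsogenyGraphs] J. Kieffer (2024), §1.2.2 p. 22 (`End(A × B)` as `2 × 2` matrices).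
-/

noncomputable section

open CategoryTheory
open Literature.AlgebraicTopology.SingularHomology
open Literature.AlgebraicGeometry.HodgeTheory
open Literature.AlgebraicGeometry.Motives
open Literature.AlgebraicGeometry.VanGeemen1994 (pullbackOne)

namespace Literature.AlgebraicGeometry.Milne1999

/-! ### §1 The four blocks of `χ^*`, `χ ∈ End(B × C)`, on `H¹(B × C) = pr_B^* H¹(B) ⊕ pr_C^* H¹(C)` -/

section Blocks

variable {B C : AbelianVariety ℂ}

/-- **First column of `χ^*`**: for `χ ∈ End(B × C)` and `b ∈ H¹(B(ℂ); ℂ)`,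
`χ^* pr_B^* b = pr_B^* ((𝟙,0) ≫ χ ≫ pr_B)^* b + pr_C^* ((0,𝟙) ≫ χ ≫ pr_B)^* b` — the `BB`-entry
`∈ End(B)` and the `CB`-entry `∈ Hom(C, B)` of the `2 × 2` matrix of `χ` (Künneth in degree one,
`eq_map_fst_add_map_snd_one`). [cite: Kieffer2024IsogenyGraphs, §1.2.2 p. 22]
[cite: HatcherAT2002, §3.2 Thm. 3.16] -/
theorem map_map_fst_one_eq_add (χ : B.prod C ⟶ B.prod C) (b : complexBetti B.X 1) :
    complexBetti.map χ.hom.hom.hom 1 (complexBetti.map (AbelianVariety.fst B C).hom.hom.hom 1 b) =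
      complexBetti.map (AbelianVariety.fst B C).hom.hom.hom 1
          (complexBetti.map (AbelianVariety.prodLift (𝟙 B) (0 : B ⟶ C) ≫ χ ≫
            AbelianVariety.fst B C).hom.hom.hom 1 b) +
        complexBetti.map (AbelianVariety.snd B C).hom.hom.hom 1
          (complexBetti.map (AbelianVariety.prodLift (0 : C ⟶ B) (𝟙 C) ≫ χ ≫
            AbelianVariety.fst B C).hom.hom.hom 1 b) := by
  have h₂ : complexBetti.map (AbelianVariety.prodLift (0 : C ⟶ B) (𝟙 C)).hom.hom.hom 1
      (complexBetti.map χ.hom.hom.hom 1 (complexBetti.map (AbelianVariety.fst B C).hom.hom.hom 1 b)) =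
      complexBetti.map (AbelianVariety.prodLift (0 : C ⟶ B) (𝟙 C) ≫ χ ≫
        AbelianVariety.fst B C).hom.hom.hom 1 b := by
    rw [complexBetti_map_comp_apply, complexBetti_map_comp_apply]
  conv_lhs => rw [eq_map_fst_add_map_snd_one (complexBetti.map χ.hom.hom.hom 1 _)]
  rw [map_inl_map_map_fst_one, h₂]

/-- **Second column of `χ^*`**: `χ^* pr_C^* c = pr_B^* ((𝟙,0) ≫ χ ≫ pr_C)^* c + pr_C^* ((0,𝟙) ≫ χ ≫ pr_C)^* c`
— the `BC`-entry `∈ Hom(B, C)` and the `CC`-entry `∈ End(C)`. [cite: Kieffer2024IsogenyGraphs, §1.2.2 p. 22]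
[cite: HatcherAT2002, §3.2 Thm. 3.16] -/
theorem map_map_snd_one_eq_add (χ : B.prod C ⟶ B.prod C) (c : complexBetti C.X 1) :
    complexBetti.map χ.hom.hom.hom 1 (complexBetti.map (AbelianVariety.snd B C).hom.hom.hom 1 c) =
      complexBetti.map (AbelianVariety.fst B C).hom.hom.hom 1
          (complexBetti.map (AbelianVariety.prodLift (𝟙 B) (0 : B ⟶ C) ≫ χ ≫
            AbelianVariety.snd B C).hom.hom.hom 1 c) +
        complexBetti.map (AbelianVariety.snd B C).hom.hom.hom 1
          (complexBetti.map (AbelianVariety.prodLift (0 : C ⟶ B) (𝟙 C) ≫ χ ≫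
            AbelianVariety.snd B C).hom.hom.hom 1 c) := by
  have h₁ : complexBetti.map (AbelianVariety.prodLift (𝟙 B) (0 : B ⟶ C)).hom.hom.hom 1
      (complexBetti.map χ.hom.hom.hom 1 (complexBetti.map (AbelianVariety.snd B C).hom.hom.hom 1 c)) =
      complexBetti.map (AbelianVariety.prodLift (𝟙 B) (0 : B ⟶ C) ≫ χ ≫
        AbelianVariety.snd B C).hom.hom.hom 1 c := by
    rw [complexBetti_map_comp_apply, complexBetti_map_comp_apply]
  conv_lhs => rw [eq_map_fst_add_map_snd_one (complexBetti.map χ.hom.hom.hom 1 _)]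
  rw [map_inr_map_map_snd_one, h₁]

/-- **A pull-back `f^* y` along `f : B × C → A` splits as `pr_B^* ((𝟙,0) ≫ f)^* y + pr_C^* ((0,𝟙) ≫ f)^* y`**
(the two components of `f`). [cite: HatcherAT2002, §3.2 Thm. 3.16] [cite: LangeBirkenhake1992, §1.1 (p. 19)] -/
theorem map_one_eq_add_of_prod {A : AbelianVariety ℂ} (f : B.prod C ⟶ A) (y : complexBetti A.X 1) :
    complexBetti.map f.hom.hom.hom 1 y =
      complexBetti.map (AbelianVariety.fst B C).hom.hom.hom 1
          (complexBetti.map (AbelianVariety.prodLift (𝟙 B) (0 : B ⟶ C) ≫ f).hom.hom.hom 1 y) +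
        complexBetti.map (AbelianVariety.snd B C).hom.hom.hom 1
          (complexBetti.map (AbelianVariety.prodLift (0 : C ⟶ B) (𝟙 C) ≫ f).hom.hom.hom 1 y) := by
  have h₁ : complexBetti.map (AbelianVariety.prodLift (𝟙 B) (0 : B ⟶ C)).hom.hom.hom 1
      (complexBetti.map f.hom.hom.hom 1 y) =
      complexBetti.map (AbelianVariety.prodLift (𝟙 B) (0 : B ⟶ C) ≫ f).hom.hom.hom 1 y :=
    (complexBetti_map_comp_apply _ _ _).symm
  have h₂ : complexBetti.map (AbelianVariety.prodLift (0 : C ⟶ B) (𝟙 C)).hom.hom.hom 1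
      (complexBetti.map f.hom.hom.hom 1 y) =
      complexBetti.map (AbelianVariety.prodLift (0 : C ⟶ B) (𝟙 C) ≫ f).hom.hom.hom 1 y :=
    (complexBetti_map_comp_apply _ _ _).symm
  conv_lhs => rw [eq_map_fst_add_map_snd_one (complexBetti.map f.hom.hom.hom 1 y)]
  rw [h₁, h₂]

/-- **A pull-back along `g : A → B × C` of a split class**:
`g^* (pr_B^* b + pr_C^* c) = (g ≫ pr_B)^* b + (g ≫ pr_C)^* c`. [cite: HatcherAT2002, §3.2 Thm. 3.16] -/
theorem map_map_fst_add_map_snd_one {A : AbelianVariety ℂ} (g : A ⟶ B.prod C) (b : complexBetti B.X 1)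
    (c : complexBetti C.X 1) :
    complexBetti.map g.hom.hom.hom 1 (complexBetti.map (AbelianVariety.fst B C).hom.hom.hom 1 b +
        complexBetti.map (AbelianVariety.snd B C).hom.hom.hom 1 c) =
      complexBetti.map (g ≫ AbelianVariety.fst B C).hom.hom.hom 1 b +
        complexBetti.map (g ≫ AbelianVariety.snd B C).hom.hom.hom 1 c := by
  rw [map_add, complexBetti_map_comp_apply, complexBetti_map_comp_apply]

end Blocks

/-! ### §2 `s ⊕ t ∈ C(B × C)` from the blocks and the off-diagonal intertwining -/

section Criterion

variable {B C : AbelianVariety ℂ}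

/-- **Block-diagonal endomorphisms commuting with `End(B × C)`.**  If `s ∈ End H¹(B)` commutes with every
`φ^*` (`φ ∈ End(B)`), `t ∈ End H¹(C)` with every `ψ^*` (`ψ ∈ End(C)`), and `s`, `t` intertwine the
off-diagonal blocks — `t (g^* b) = g^* (s b)` for `g ∈ Hom(C, B)`, `s (f^* c) = f^* (t c)` for
`f ∈ Hom(B, C)` — then `s ⊕ t` commutes with `χ^*` for every `χ ∈ End(B × C)` (expand `χ` into its four
blocks, §1).  Milne §1 p. 643: the diagonal `C(A)` acts on `rV(A)` inside `C(A^r)`; and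
`C(A₁) × C(A₂) = C(A₁ × A₂)` when `Hom(Aᵢ, Aⱼ) = 0` (the case of vacuous intertwining,
`prodBlockDiag_apply_map_of_hom_eq_zero`). [cite: Milne1999LefschetzClasses, §1 p. 643] -/
theorem prodBlockDiag_apply_map_of_intertwine
    {s : Module.End ℂ (complexBetti B.X 1)} {t : Module.End ℂ (complexBetti C.X 1)}
    (hs : ∀ (φ : B ⟶ B) (b : complexBetti B.X 1),
      s (complexBetti.map φ.hom.hom.hom 1 b) = complexBetti.map φ.hom.hom.hom 1 (s b))
    (ht : ∀ (ψ : C ⟶ C) (c : complexBetti C.X 1),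
      t (complexBetti.map ψ.hom.hom.hom 1 c) = complexBetti.map ψ.hom.hom.hom 1 (t c))
    (hts : ∀ (g : C ⟶ B) (b : complexBetti B.X 1),
      t (complexBetti.map g.hom.hom.hom 1 b) = complexBetti.map g.hom.hom.hom 1 (s b))
    (hst : ∀ (f : B ⟶ C) (c : complexBetti C.X 1),
      s (complexBetti.map f.hom.hom.hom 1 c) = complexBetti.map f.hom.hom.hom 1 (t c))
    (χ : B.prod C ⟶ B.prod C) (x : complexBetti (B.prod C).X 1) :
    prodBlockDiag s t (complexBetti.map χ.hom.hom.hom 1 x) =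
      complexBetti.map χ.hom.hom.hom 1 (prodBlockDiag s t x) := by
  rw [eq_map_fst_add_map_snd_one x]
  set b := complexBetti.map (AbelianVariety.prodLift (𝟙 B) (0 : B ⟶ C)).hom.hom.hom 1 x
  set c := complexBetti.map (AbelianVariety.prodLift (0 : C ⟶ B) (𝟙 C)).hom.hom.hom 1 x
  rw [map_add, map_add, map_add, map_add, map_map_fst_one_eq_add χ b, map_map_snd_one_eq_add χ c,
    map_add, map_add, prodBlockDiag_apply_map_fst, prodBlockDiag_apply_map_snd, prodBlockDiag_apply_map_fst,
    prodBlockDiag_apply_map_snd, prodBlockDiag_apply_map_fst, prodBlockDiag_apply_map_snd,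
    map_map_fst_one_eq_add χ (s b), map_map_snd_one_eq_add χ (t c), hs, hts, hst, ht]

/-- **The criterion for `s ⊕ t ∈ C(B × C)`** (automorphisms): `s ∈ C(B)`, `t ∈ C(C)`, and the two
intertwining relations with `Hom(C, B)^*`, `Hom(B, C)^*`. [cite: Milne1999LefschetzClasses, §1 p. 643] -/
theorem prodBlockDiagEquiv_mem_centralizerGroup_of_intertwine
    {s : complexBetti B.X 1 ≃ₗ[ℂ] complexBetti B.X 1} {t : complexBetti C.X 1 ≃ₗ[ℂ] complexBetti C.X 1}
    (hs : s ∈ centralizerGroup B) (ht : t ∈ centralizerGroup C)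
    (hts : ∀ (g : C ⟶ B) (b : complexBetti B.X 1),
      t (complexBetti.map g.hom.hom.hom 1 b) = complexBetti.map g.hom.hom.hom 1 (s b))
    (hst : ∀ (f : B ⟶ C) (c : complexBetti C.X 1),
      s (complexBetti.map f.hom.hom.hom 1 c) = complexBetti.map f.hom.hom.hom 1 (t c)) :
    prodBlockDiagEquiv s t ∈ centralizerGroup (B.prod C) :=
  fun χ x ↦ prodBlockDiag_apply_map_of_intertwine (fun φ b ↦ hs φ b) (fun ψ c ↦ ht ψ c)
    (fun g b ↦ hts g b) (fun f c ↦ hst f c) χ x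

/-- `(s ⊕ t) x = prodBlockDiag s t x` (the automorphism and the endomorphism agree pointwise).
[cite: Milne1999LefschetzClasses, §1 p. 643] -/
theorem prodBlockDiagEquiv_apply (s : complexBetti B.X 1 ≃ₗ[ℂ] complexBetti B.X 1)
    (t : complexBetti C.X 1 ≃ₗ[ℂ] complexBetti C.X 1) (x : complexBetti (B.prod C).X 1) :
    prodBlockDiagEquiv s t x = prodBlockDiag s.toLinearMap t.toLinearMap x :=
  rfl

/-- `(s ⊕ t) (pr_B^* b) = pr_B^* (s b)`. [cite: Milne1999LefschetzClasses, §1 p. 643] -/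
theorem prodBlockDiagEquiv_apply_map_fst (s : complexBetti B.X 1 ≃ₗ[ℂ] complexBetti B.X 1)
    (t : complexBetti C.X 1 ≃ₗ[ℂ] complexBetti C.X 1) (b : complexBetti B.X 1) :
    prodBlockDiagEquiv s t (complexBetti.map (AbelianVariety.fst B C).hom.hom.hom 1 b) =
      complexBetti.map (AbelianVariety.fst B C).hom.hom.hom 1 (s b) :=
  prodBlockDiag_apply_map_fst _ _ b

/-- `(s ⊕ t) (pr_C^* c) = pr_C^* (t c)`. [cite: Milne1999LefschetzClasses, §1 p. 643] -/
theorem prodBlockDiagEquiv_apply_map_snd (s : complexBetti B.X 1 ≃ₗ[ℂ] complexBetti B.X 1)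
    (t : complexBetti C.X 1 ≃ₗ[ℂ] complexBetti C.X 1) (c : complexBetti C.X 1) :
    prodBlockDiagEquiv s t (complexBetti.map (AbelianVariety.snd B C).hom.hom.hom 1 c) =
      complexBetti.map (AbelianVariety.snd B C).hom.hom.hom 1 (t c) :=
  prodBlockDiag_apply_map_snd _ _ c

/-- The `B`-block of `s ⊕ t` is `s` (pointwise). [cite: Milne1999LefschetzClasses, §1 p. 643] -/
theorem prodRestrictFst_prodBlockDiagEquiv_apply (s : complexBetti B.X 1 ≃ₗ[ℂ] complexBetti B.X 1)
    (t : complexBetti C.X 1 ≃ₗ[ℂ] complexBetti C.X 1) (b : complexBetti B.X 1) :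
    prodRestrictFst (prodBlockDiagEquiv s t).toLinearMap b = s b := by
  rw [coe_prodBlockDiagEquiv, prodRestrictFst_prodBlockDiag]
  rfl

/-- The `C`-block of `s ⊕ t` is `t` (pointwise). [cite: Milne1999LefschetzClasses, §1 p. 643] -/
theorem prodRestrictSnd_prodBlockDiagEquiv_apply (s : complexBetti B.X 1 ≃ₗ[ℂ] complexBetti B.X 1)
    (t : complexBetti C.X 1 ≃ₗ[ℂ] complexBetti C.X 1) (c : complexBetti C.X 1) :
    prodRestrictSnd (prodBlockDiagEquiv s t).toLinearMap c = t c := by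
  rw [coe_prodBlockDiagEquiv, prodRestrictSnd_prodBlockDiag]
  rfl

/-- `𝟙 ⊕ 𝟙 = 𝟙`. [cite: HatcherAT2002, §3.2 Thm. 3.16] -/
theorem prodBlockDiagEquiv_one :
    prodBlockDiagEquiv (1 : complexBetti B.X 1 ≃ₗ[ℂ] complexBetti B.X 1)
      (1 : complexBetti C.X 1 ≃ₗ[ℂ] complexBetti C.X 1) = 1 := by
  refine LinearEquiv.toLinearMap_injective ?_
  rw [coe_prodBlockDiagEquiv]
  exact prodBlockDiag_one

/-- `(s ⊕ t) (s' ⊕ t') = (s s') ⊕ (t t')`. [cite: Milne1999LefschetzClasses, §1 p. 643] -/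
theorem prodBlockDiagEquiv_mul (s s' : complexBetti B.X 1 ≃ₗ[ℂ] complexBetti B.X 1)
    (t t' : complexBetti C.X 1 ≃ₗ[ℂ] complexBetti C.X 1) :
    prodBlockDiagEquiv (s * s') (t * t') = prodBlockDiagEquiv s t * prodBlockDiagEquiv s' t' := by
  refine LinearEquiv.toLinearMap_injective ?_
  rw [LinearEquiv.coe_toLinearMap_mul, coe_prodBlockDiagEquiv, coe_prodBlockDiagEquiv, coe_prodBlockDiagEquiv,
    LinearEquiv.coe_toLinearMap_mul, LinearEquiv.coe_toLinearMap_mul, prodBlockDiag_mul]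

/-- The test endomorphism `χ_g = pr_C ≫ g ≫ (𝟙, 0) ∈ End(B × C)` of `g ∈ Hom(C, B)` moves `pr_B^* H¹(B)` to
`pr_C^* H¹(C)` through `g^*`: `χ_g^* pr_B^* b = pr_C^* g^* b`. [cite: Milne1999LefschetzClasses, §1 p. 643]
[cite: LangeBirkenhake1992, §1.1 (p. 19)] -/
theorem map_sndHomInl_map_fst_one (g : C ⟶ B) (b : complexBetti B.X 1) :
    complexBetti.map (AbelianVariety.snd B C ≫ g ≫ AbelianVariety.prodLift (𝟙 B) (0 : B ⟶ C)).hom.hom.hom 1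
        (complexBetti.map (AbelianVariety.fst B C).hom.hom.hom 1 b) =
      complexBetti.map (AbelianVariety.snd B C).hom.hom.hom 1 (complexBetti.map g.hom.hom.hom 1 b) := by
  rw [← complexBetti_map_comp_apply, Category.assoc, Category.assoc, AbelianVariety.prodLift_fst,
    Category.comp_id, complexBetti_map_comp_apply]

/-- The test endomorphism `χ_f = pr_B ≫ f ≫ (0, 𝟙) ∈ End(B × C)` of `f ∈ Hom(B, C)`:
`χ_f^* pr_C^* c = pr_B^* f^* c`. [cite: Milne1999LefschetzClasses, §1 p. 643] [cite: LangeBirkenhake1992, §1.1 (p. 19)] -/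
theorem map_fstHomInr_map_snd_one (f : B ⟶ C) (c : complexBetti C.X 1) :
    complexBetti.map (AbelianVariety.fst B C ≫ f ≫ AbelianVariety.prodLift (0 : C ⟶ B) (𝟙 C)).hom.hom.hom 1
        (complexBetti.map (AbelianVariety.snd B C).hom.hom.hom 1 c) =
      complexBetti.map (AbelianVariety.fst B C).hom.hom.hom 1 (complexBetti.map f.hom.hom.hom 1 c) := by
  rw [← complexBetti_map_comp_apply, Category.assoc, Category.assoc, AbelianVariety.prodLift_snd,
    Category.comp_id, complexBetti_map_comp_apply]

/-- **Converse, first relation**: if `s ⊕ t ∈ C(B × C)` then `t (g^* b) = g^* (s b)` for every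
`g ∈ Hom(C, B)` (test `s ⊕ t` against `χ_g = pr_C ≫ g ≫ (𝟙, 0)`; `pr_C^*` is injective on `H¹`).
[cite: Milne1999LefschetzClasses, §1 p. 643] -/
theorem intertwine_of_prodBlockDiagEquiv_mem_centralizerGroup_left
    {s : complexBetti B.X 1 ≃ₗ[ℂ] complexBetti B.X 1} {t : complexBetti C.X 1 ≃ₗ[ℂ] complexBetti C.X 1}
    (h : prodBlockDiagEquiv s t ∈ centralizerGroup (B.prod C)) (g : C ⟶ B) (b : complexBetti B.X 1) :
    t (complexBetti.map g.hom.hom.hom 1 b) = complexBetti.map g.hom.hom.hom 1 (s b) := by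
  apply map_snd_injective_one (A := B) (B := C)
  have hχ : prodBlockDiagEquiv s t
      (complexBetti.map (AbelianVariety.snd B C ≫ g ≫ AbelianVariety.prodLift (𝟙 B) (0 : B ⟶ C)).hom.hom.hom 1
        (complexBetti.map (AbelianVariety.fst B C).hom.hom.hom 1 b)) =
      complexBetti.map (AbelianVariety.snd B C ≫ g ≫ AbelianVariety.prodLift (𝟙 B) (0 : B ⟶ C)).hom.hom.hom 1
        (prodBlockDiagEquiv s t (complexBetti.map (AbelianVariety.fst B C).hom.hom.hom 1 b)) := h _ _
  rw [prodBlockDiagEquiv_apply_map_fst, map_sndHomInl_map_fst_one, map_sndHomInl_map_fst_one,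
    prodBlockDiagEquiv_apply_map_snd] at hχ
  exact hχ

/-- **Converse, second relation**: if `s ⊕ t ∈ C(B × C)` then `s (f^* c) = f^* (t c)` for every
`f ∈ Hom(B, C)`. [cite: Milne1999LefschetzClasses, §1 p. 643] -/
theorem intertwine_of_prodBlockDiagEquiv_mem_centralizerGroup_right
    {s : complexBetti B.X 1 ≃ₗ[ℂ] complexBetti B.X 1} {t : complexBetti C.X 1 ≃ₗ[ℂ] complexBetti C.X 1}
    (h : prodBlockDiagEquiv s t ∈ centralizerGroup (B.prod C)) (f : B ⟶ C) (c : complexBetti C.X 1) :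
    s (complexBetti.map f.hom.hom.hom 1 c) = complexBetti.map f.hom.hom.hom 1 (t c) := by
  apply map_fst_injective_one (A := B) (B := C)
  have hχ : prodBlockDiagEquiv s t
      (complexBetti.map (AbelianVariety.fst B C ≫ f ≫ AbelianVariety.prodLift (0 : C ⟶ B) (𝟙 C)).hom.hom.hom 1
        (complexBetti.map (AbelianVariety.snd B C).hom.hom.hom 1 c)) =
      complexBetti.map (AbelianVariety.fst B C ≫ f ≫ AbelianVariety.prodLift (0 : C ⟶ B) (𝟙 C)).hom.hom.hom 1
        (prodBlockDiagEquiv s t (complexBetti.map (AbelianVariety.snd B C).hom.hom.hom 1 c)) := h _ _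
  rw [prodBlockDiagEquiv_apply_map_snd, map_fstHomInr_map_snd_one, map_fstHomInr_map_snd_one,
    prodBlockDiagEquiv_apply_map_fst] at hχ
  exact hχ

/-- **The criterion is sharp**: `s ⊕ t ∈ C(B × C)` iff `s ∈ C(B)`, `t ∈ C(C)` and the two intertwining
relations hold (the blocks of an element of `C(B × C)` lie in `C(B)`, `C(C)`:
`centralizerGroup.restrictFstHom_mem` / `…SndHom_mem`). [cite: Milne1999LefschetzClasses, §1 p. 643] -/
theorem prodBlockDiagEquiv_mem_centralizerGroup_iff
    {s : complexBetti B.X 1 ≃ₗ[ℂ] complexBetti B.X 1} {t : complexBetti C.X 1 ≃ₗ[ℂ] complexBetti C.X 1} :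
    prodBlockDiagEquiv s t ∈ centralizerGroup (B.prod C) ↔
      s ∈ centralizerGroup B ∧ t ∈ centralizerGroup C ∧
        (∀ (g : C ⟶ B) (b : complexBetti B.X 1),
          t (complexBetti.map g.hom.hom.hom 1 b) = complexBetti.map g.hom.hom.hom 1 (s b)) ∧
        (∀ (f : B ⟶ C) (c : complexBetti C.X 1),
          s (complexBetti.map f.hom.hom.hom 1 c) = complexBetti.map f.hom.hom.hom 1 (t c)) := by
  refine ⟨fun h ↦ ⟨?_, ?_, intertwine_of_prodBlockDiagEquiv_mem_centralizerGroup_left h,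
    intertwine_of_prodBlockDiagEquiv_mem_centralizerGroup_right h⟩,
    fun h ↦ prodBlockDiagEquiv_mem_centralizerGroup_of_intertwine h.1 h.2.1 h.2.2.1 h.2.2.2⟩
  · have e := centralizerGroup.restrictFstHom_prodBlockDiagEquiv h
    rw [← e]
    exact centralizerGroup.restrictFstHom_mem _
  · have e := centralizerGroup.restrictSndHom_prodBlockDiagEquiv h
    rw [← e]
    exact centralizerGroup.restrictSndHom_mem _

end Criterion

/-! ### §3 The diagonal action `u ↦ u^{⊕(a+1)}` on `H¹(A^{a+1}) = (a+1) H¹(A)` and the product polarization -/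

section Diagonal

variable (A : AbelianVariety ℂ)

/-- **The diagonal action of `GL(H¹(A(ℂ); ℂ))` on `H¹(A^{a+1}(ℂ); ℂ) = (a+1) · H¹(A(ℂ); ℂ)`**:
`u ↦ u^{⊕(a+1)}`, by the recursion `u^{⊕1} = u`, `u^{⊕(a+2)} = u^{⊕(a+1)} ⊕ u` along
`A^{a+2} = A^{a+1} × A` (Milne §1 p. 643: "the diagonal action of `C(A)` on `rV(A)`").  A `def` with a
body (a linear-algebra construction; nothing is asserted). [cite: Milne1999LefschetzClasses, §1 p. 643] -/
def diagPow (u : complexBetti A.X 1 ≃ₗ[ℂ] complexBetti A.X 1) :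
    ∀ a : ℕ, complexBetti (A.powSucc a).X 1 ≃ₗ[ℂ] complexBetti (A.powSucc a).X 1
  | 0 => u
  | a + 1 => prodBlockDiagEquiv (diagPow u a) u

/-- **The class `Σᵢ prᵢ^* h ∈ H²(A^{a+1}(ℂ); ℂ)` of Milne's divisor `D = Σᵢ A × ⋯ × Dᵢ × ⋯ × A` on the power
`A^{a+1}`** (all `Dᵢ = D` of class `h`), by the recursion `h^{(1)} = h`,
`h^{(a+2)} = pr_{A^{a+1}}^* h^{(a+1)} + pr_A^* h` (`prodPolarizationClass`).  A `def` with a body.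
[cite: Milne1999LefschetzClasses, §1 p. 643] [cite: LangeBirkenhake1992, §5.3] -/
def powPolarizationClass (h : complexBetti A.X 2) : ∀ a : ℕ, complexBetti (A.powSucc a).X 2
  | 0 => h
  | a + 1 => prodPolarizationClass (A.powSucc a) A (powPolarizationClass h a) h

variable {A} (u v : complexBetti A.X 1 ≃ₗ[ℂ] complexBetti A.X 1) (h : complexBetti A.X 2)

/-- `u^{⊕1} = u` (`A^1 = A`). [cite: Milne1999LefschetzClasses, §1 p. 643] -/
@[simp] theorem diagPow_zero : diagPow A u 0 = u := rfl

/-- `u^{⊕(a+2)} = u^{⊕(a+1)} ⊕ u` on `A^{a+2} = A^{a+1} × A`. [cite: Milne1999LefschetzClasses, §1 p. 643] -/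
theorem diagPow_succ (a : ℕ) : diagPow A u (a + 1) = prodBlockDiagEquiv (diagPow A u a) u := rfl

/-- `h^{(1)} = h`. [cite: Milne1999LefschetzClasses, §1 p. 643] -/
@[simp] theorem powPolarizationClass_zero : powPolarizationClass A h 0 = h := rfl

/-- `h^{(a+2)} = pr^* h^{(a+1)} + pr_A^* h`. [cite: Milne1999LefschetzClasses, §1 p. 643] -/
theorem powPolarizationClass_succ (a : ℕ) :
    powPolarizationClass A h (a + 1) = prodPolarizationClass (A.powSucc a) A (powPolarizationClass A h a) h :=
  rfl

/-- The diagonal action is unital: `𝟙^{⊕(a+1)} = 𝟙`. [cite: Milne1999LefschetzClasses, §1 p. 643] -/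
theorem diagPow_one : ∀ a : ℕ, diagPow A (1 : complexBetti A.X 1 ≃ₗ[ℂ] complexBetti A.X 1) a = 1
  | 0 => rfl
  | a + 1 => by rw [diagPow_succ, diagPow_one a, prodBlockDiagEquiv_one]; rfl

/-- The diagonal action is multiplicative: `(u v)^{⊕(a+1)} = u^{⊕(a+1)} v^{⊕(a+1)}` ("`C(A)` acts on
`rV(A)`" by algebra homomorphisms). [cite: Milne1999LefschetzClasses, §1 p. 643] -/
theorem diagPow_mul : ∀ a : ℕ, diagPow A (u * v) a = diagPow A u a * diagPow A v a
  | 0 => rfl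
  | a + 1 => by rw [diagPow_succ, diagPow_succ, diagPow_succ, diagPow_mul a, prodBlockDiagEquiv_mul]; rfl

/-- `u^{⊕(a+2)}` acts on the summand `pr^* H¹(A^{a+1})` through `u^{⊕(a+1)}`. [cite: Milne1999LefschetzClasses, §1 p. 643] -/
theorem diagPow_succ_apply_map_fst (a : ℕ) (p : complexBetti (A.powSucc a).X 1) :
    diagPow A u (a + 1) (complexBetti.map (AbelianVariety.fst (A.powSucc a) A).hom.hom.hom 1 p) =
      complexBetti.map (AbelianVariety.fst (A.powSucc a) A).hom.hom.hom 1 (diagPow A u a p) :=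
  prodBlockDiagEquiv_apply_map_fst _ _ p

/-- `u^{⊕(a+2)}` acts on the last summand `pr_A^* H¹(A)` through `u`. [cite: Milne1999LefschetzClasses, §1 p. 643] -/
theorem diagPow_succ_apply_map_snd (a : ℕ) (y : complexBetti A.X 1) :
    diagPow A u (a + 1) (complexBetti.map (AbelianVariety.snd (A.powSucc a) A).hom.hom.hom 1 y) =
      complexBetti.map (AbelianVariety.snd (A.powSucc a) A).hom.hom.hom 1 (u y) :=
  prodBlockDiagEquiv_apply_map_snd _ _ y

/-- The last block of `u^{⊕(a+2)}` is `u`: **the diagonal action is faithful**. [cite: Milne1999LefschetzClasses, §1 p. 643] -/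
theorem prodRestrictSnd_diagPow_succ (a : ℕ) (y : complexBetti A.X 1) :
    prodRestrictSnd (diagPow A u (a + 1)).toLinearMap y = u y :=
  prodRestrictSnd_prodBlockDiagEquiv_apply _ _ y

/-- The first block of `u^{⊕(a+2)}` is `u^{⊕(a+1)}`. [cite: Milne1999LefschetzClasses, §1 p. 643] -/
theorem prodRestrictFst_diagPow_succ (a : ℕ) (p : complexBetti (A.powSucc a).X 1) :
    prodRestrictFst (diagPow A u (a + 1)).toLinearMap p = diagPow A u a p :=
  prodRestrictFst_prodBlockDiagEquiv_apply _ _ p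

/-- `u ↦ u^{⊕(a+1)}` is injective. [cite: Milne1999LefschetzClasses, §1 p. 643] -/
theorem diagPow_injective (a : ℕ) : Function.Injective fun u : complexBetti A.X 1 ≃ₗ[ℂ] complexBetti A.X 1 ↦
    diagPow A u a := by
  induction a with
  | zero => exact fun u v huv ↦ huv
  | succ a _ =>
    intro u v huv
    refine LinearEquiv.ext fun y ↦ ?_
    have e := congrArg (fun w : complexBetti (A.powSucc (a + 1)).X 1 ≃ₗ[ℂ] complexBetti (A.powSucc (a + 1)).X 1 ↦
      prodRestrictSnd w.toLinearMap y) huv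
    simpa only [prodRestrictSnd_diagPow_succ] using e

/-- Powers of a positive-dimensional abelian variety are positive-dimensional:
`dim A^{a+1} = (a+1) dim A`. [cite: Milne1999LefschetzClasses, §1 p. 643 (V(A^r) = rV(A))] -/
theorem dim_powSucc_pos (hA0 : 0 < A.dim) : ∀ a : ℕ, 0 < (A.powSucc a).dim
  | 0 => hA0
  | a + 1 => by
    rw [AbelianVariety.powSucc_succ, AbelianVariety.dim_prod]
    exact Nat.add_pos_right _ hA0

end Diagonal

/-! ### §4 `u ∈ C(A) ⟹ u^{⊕(a+1)} ∈ C(A^{a+1})` -/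

section Centralizer

variable {A : AbelianVariety ℂ} {u : complexBetti A.X 1 ≃ₗ[ℂ] complexBetti A.X 1}

/-- **The diagonal action of `C(A)` lands in `C(A^{a+1})`, with its intertwining relations** (the
induction behind Milne's "the diagonal action of `C(A)` on `rV(A)` identifies `C(A)` with `C(A^r)`",
§1 p. 643): for `u ∈ C(A)`, (i) `u^{⊕(a+1)} ∈ C(A^{a+1})`; (ii) `u (g^* p) = g^* (u^{⊕(a+1)} p)` for every
`g ∈ Hom(A, A^{a+1})`; (iii) `u^{⊕(a+1)} (f^* y) = f^* (u y)` for every `f ∈ Hom(A^{a+1}, A)`.  Step: (i)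
at `a + 1` is the criterion of §2 fed with (i)–(iii) at `a`; (ii), (iii) propagate through the two
components of `g`, `f`. [cite: Milne1999LefschetzClasses, §1 p. 643] -/
theorem diagPow_mem_centralizerGroup_and_intertwine (hu : u ∈ centralizerGroup A) : ∀ a : ℕ,
    diagPow A u a ∈ centralizerGroup (A.powSucc a) ∧
      (∀ (g : A ⟶ A.powSucc a) (p : complexBetti (A.powSucc a).X 1),
        u (complexBetti.map g.hom.hom.hom 1 p) = complexBetti.map g.hom.hom.hom 1 (diagPow A u a p)) ∧
      (∀ (f : A.powSucc a ⟶ A) (y : complexBetti A.X 1),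
        diagPow A u a (complexBetti.map f.hom.hom.hom 1 y) = complexBetti.map f.hom.hom.hom 1 (u y))
  | 0 => ⟨hu, fun g p ↦ hu g p, fun f y ↦ hu f y⟩
  | a + 1 => by
    obtain ⟨h₁, h₂, h₃⟩ := diagPow_mem_centralizerGroup_and_intertwine hu a
    -- `hu` in the `complexBetti.map` spelling (definitionally `pullbackOne`)
    have hu' : ∀ (φ : A ⟶ A) (y : complexBetti A.X 1),
        u (complexBetti.map φ.hom.hom.hom 1 y) = complexBetti.map φ.hom.hom.hom 1 (u y) := fun φ y ↦ hu φ y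
    -- (ii) on `A^{a+1} × A`, in the product spelling: `g = (g ≫ pr, g ≫ pr_A)`
    have key₂ : ∀ (g : A ⟶ (A.powSucc a).prod A) (x : complexBetti ((A.powSucc a).prod A).X 1),
        u (complexBetti.map g.hom.hom.hom 1 x) =
          complexBetti.map g.hom.hom.hom 1 (prodBlockDiagEquiv (diagPow A u a) u x) := by
      intro g x
      obtain ⟨p, y, rfl⟩ : ∃ (p : complexBetti (A.powSucc a).X 1) (y : complexBetti A.X 1),
          x = complexBetti.map (AbelianVariety.fst (A.powSucc a) A).hom.hom.hom 1 p +
            complexBetti.map (AbelianVariety.snd (A.powSucc a) A).hom.hom.hom 1 y :=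
        ⟨_, _, eq_map_fst_add_map_snd_one x⟩
      rw [map_add (prodBlockDiagEquiv (diagPow A u a) u), prodBlockDiagEquiv_apply_map_fst,
        prodBlockDiagEquiv_apply_map_snd, map_map_fst_add_map_snd_one, map_map_fst_add_map_snd_one, map_add,
        h₂ (g ≫ AbelianVariety.fst (A.powSucc a) A) p, hu' (g ≫ AbelianVariety.snd (A.powSucc a) A) y]
    -- (iii) in the product spelling: `f = ((𝟙,0) ≫ f) + ((0,𝟙) ≫ f)` on the two summands
    have key₃ : ∀ (f : (A.powSucc a).prod A ⟶ A) (y : complexBetti A.X 1),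
        prodBlockDiagEquiv (diagPow A u a) u (complexBetti.map f.hom.hom.hom 1 y) =
          complexBetti.map f.hom.hom.hom 1 (u y) := by
      intro f y
      rw [map_one_eq_add_of_prod f y, map_one_eq_add_of_prod f (u y), map_add,
        prodBlockDiagEquiv_apply_map_fst, prodBlockDiagEquiv_apply_map_snd,
        h₃ (AbelianVariety.prodLift (𝟙 (A.powSucc a)) (0 : A.powSucc a ⟶ A) ≫ f) y,
        hu' (AbelianVariety.prodLift (0 : A ⟶ A.powSucc a) (𝟙 A) ≫ f) y]
    refine ⟨?_, fun g x ↦ key₂ g x, fun f y ↦ key₃ f y⟩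
    -- (i): the criterion of §2 on `A^{a+1} × A`
    exact prodBlockDiagEquiv_mem_centralizerGroup_of_intertwine h₁ hu (fun g p ↦ h₂ g p) (fun f y ↦ h₃ f y)

/-- **`u ∈ C(A) ⟹ u^{⊕(a+1)} ∈ C(A^{a+1})`** — the diagonal action of `C(A)` on `V(A^r) = rV(A)` commutes
with `End(A^r) = M_r(End(A))` (Milne §1 p. 643). [cite: Milne1999LefschetzClasses, §1 p. 643] -/
theorem diagPow_mem_centralizerGroup (hu : u ∈ centralizerGroup A) (a : ℕ) :
    diagPow A u a ∈ centralizerGroup (A.powSucc a) :=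
  (diagPow_mem_centralizerGroup_and_intertwine hu a).1

/-- Intertwining with `Hom(A, A^{a+1})`: `u (g^* p) = g^* (u^{⊕(a+1)} p)` (each component `g ≫ prᵢ ∈ End(A)`
commutes with `u`). [cite: Milne1999LefschetzClasses, §1 p. 643] -/
theorem diagPow_intertwine_left (hu : u ∈ centralizerGroup A) {a : ℕ} (g : A ⟶ A.powSucc a)
    (p : complexBetti (A.powSucc a).X 1) :
    u (complexBetti.map g.hom.hom.hom 1 p) = complexBetti.map g.hom.hom.hom 1 (diagPow A u a p) :=
  (diagPow_mem_centralizerGroup_and_intertwine hu a).2.1 g p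

/-- Intertwining with `Hom(A^{a+1}, A)`: `u^{⊕(a+1)} (f^* y) = f^* (u y)` (`f = Σᵢ prᵢ ≫ fᵢ` with
`fᵢ ∈ End(A)` commuting with `u`). [cite: Milne1999LefschetzClasses, §1 p. 643] -/
theorem diagPow_intertwine_right (hu : u ∈ centralizerGroup A) {a : ℕ} (f : A.powSucc a ⟶ A)
    (y : complexBetti A.X 1) :
    diagPow A u a (complexBetti.map f.hom.hom.hom 1 y) = complexBetti.map f.hom.hom.hom 1 (u y) :=
  (diagPow_mem_centralizerGroup_and_intertwine hu a).2.2 f y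

variable (A)

/-- **The diagonal embedding `C(A) → C(A^{a+1})` as a group homomorphism** (`u ↦ u^{⊕(a+1)}`; Milne:
"identifies `C(A)` with `C(A^r)`" — here the embedding; it is injective by `diagPow_injective`).
[cite: Milne1999LefschetzClasses, §1 p. 643] -/
def centralizerGroup.diagPowHom (a : ℕ) : centralizerGroup A →* centralizerGroup (A.powSucc a) where
  toFun u := ⟨diagPow A (u : complexBetti A.X 1 ≃ₗ[ℂ] complexBetti A.X 1) a, diagPow_mem_centralizerGroup u.2 a⟩
  map_one' := Subtype.ext (diagPow_one a)
  map_mul' _ _ := Subtype.ext (diagPow_mul _ _ a)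

variable {A}

/-- The underlying automorphism of `diagPowHom a u` is `u^{⊕(a+1)}`. [cite: Milne1999LefschetzClasses, §1 p. 643] -/
theorem centralizerGroup.coe_diagPowHom (a : ℕ) (u : centralizerGroup A) :
    (centralizerGroup.diagPowHom A a u : complexBetti (A.powSucc a).X 1 ≃ₗ[ℂ] complexBetti (A.powSucc a).X 1) =
      diagPow A (u : complexBetti A.X 1 ≃ₗ[ℂ] complexBetti A.X 1) a :=
  rfl

/-- `diagPowHom a` is injective. [cite: Milne1999LefschetzClasses, §1 p. 643] -/
theorem centralizerGroup.diagPowHom_injective (a : ℕ) :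
    Function.Injective (centralizerGroup.diagPowHom A a) :=
  fun _ _ huv ↦ Subtype.ext (diagPow_injective a (congrArg Subtype.val huv))

variable (A)

/-- A factor inclusion of `A` into `A^{a+1}` with its retraction (`A = A^1`; the last factor
`(0, 𝟙) : A → A^{a+1} × A` with `pr_A`). [cite: Milne1999LefschetzClasses, §1 p. 643 (V(A^r) = rV(A))] -/
theorem exists_section_powSucc : ∀ a : ℕ, ∃ (ι : A ⟶ A.powSucc a) (π : A.powSucc a ⟶ A), ι ≫ π = 𝟙 A
  | 0 => ⟨𝟙 A, 𝟙 A, Category.comp_id _⟩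
  | a + 1 => ⟨AbelianVariety.prodLift (0 : A ⟶ A.powSucc a) (𝟙 A), AbelianVariety.snd (A.powSucc a) A,
      AbelianVariety.prodLift_snd _ _⟩

variable {A}

/-- `(ι ≫ π)^* = 𝟙` on `H¹(A)` for a section–retraction pair: `ι^* (π^* y) = y`. [cite: HatcherAT2002, §3.2 Thm. 3.16] -/
theorem map_map_one_of_comp_eq_id {P : AbelianVariety ℂ} {ι : A ⟶ P} {π : P ⟶ A} (h : ι ≫ π = 𝟙 A)
    (y : complexBetti A.X 1) :
    complexBetti.map ι.hom.hom.hom 1 (complexBetti.map π.hom.hom.hom 1 y) = y := by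
  rw [← complexBetti_map_comp_apply, h]
  change complexBetti.map (𝟙 A.X) 1 y = y
  rw [complexBetti.map_id]
  rfl

/-- **"identifies": every element of `C(A^{a+1})` is diagonal** — for `U ∈ C(A^{a+1})` there is
`u ∈ C(A)` with `U = u^{⊕(a+1)}` (Milne §1 p. 643: "the diagonal action of `C(A)` on `rV(A)` identifies
`C(A)` with `C(A^r)`").  Step `A^{a+2} = A^{a+1} × A`: `U = U' ⊕ t` is block diagonal
(`prodBlockDiag_eq_of_mem_centralizerGroup`) with `U' = u^{⊕(a+1)}` by induction, and testing `U` against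
the endomorphisms `pr_A ≫ g ≫ (𝟙, 0)`, `g ∈ Hom(A, A^{a+1})` a factor inclusion, forces `t = u`.
[cite: Milne1999LefschetzClasses, §1 p. 643] -/
theorem exists_eq_diagPow_of_mem_centralizerGroup :
    ∀ (a : ℕ) (U : complexBetti (A.powSucc a).X 1 ≃ₗ[ℂ] complexBetti (A.powSucc a).X 1),
      U ∈ centralizerGroup (A.powSucc a) → ∃ u ∈ centralizerGroup A, diagPow A u a = U
  | 0, U, hU => ⟨U, hU, rfl⟩
  | a + 1, U, hU => by
    have hU' : U ∈ centralizerGroup ((A.powSucc a).prod A) := hU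
    -- the two blocks of `U`
    set U' := centralizerGroup.restrictFstHom (A.powSucc a) A ⟨U, hU'⟩ with hU'def
    set t := centralizerGroup.restrictSndHom (A.powSucc a) A ⟨U, hU'⟩ with htdef
    have hblock : prodBlockDiagEquiv U' t = U := by
      refine LinearEquiv.toLinearMap_injective ?_
      rw [coe_prodBlockDiagEquiv, hU'def, htdef, centralizerGroup.coe_restrictFstHom,
        centralizerGroup.coe_restrictSndHom]
      exact prodBlockDiag_eq_of_mem_centralizerGroup hU'
    have hmem : prodBlockDiagEquiv U' t ∈ centralizerGroup ((A.powSucc a).prod A) := by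
      rw [hblock]; exact hU'
    -- the first block is diagonal by induction
    obtain ⟨u, hu, huU'⟩ := exists_eq_diagPow_of_mem_centralizerGroup a U'
      (centralizerGroup.restrictFstHom_mem _)
    -- the last block equals `u`: test against a factor inclusion `ι : A → A^{a+1}`
    obtain ⟨ι, π, hιπ⟩ := exists_section_powSucc A a
    have ht : t = u := by
      refine LinearEquiv.ext fun y ↦ ?_
      rw [← map_map_one_of_comp_eq_id hιπ y,
        intertwine_of_prodBlockDiagEquiv_mem_centralizerGroup_left hmem ι, ← huU',
        diagPow_intertwine_left hu ι]
    refine ⟨u, hu, ?_⟩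
    show prodBlockDiagEquiv (diagPow A u a) u = U
    rw [huU', ← ht]
    exact hblock

variable (A)

/-- **`C(A) ≅ C(A^{a+1})` by the diagonal action** (Milne §1 p. 643, on `ℂ`-points and read on `H¹`):
`u ↦ u^{⊕(a+1)}` is a group isomorphism `centralizerGroup A ≃* centralizerGroup (A.powSucc a)`.
[cite: Milne1999LefschetzClasses, §1 p. 643] -/
def centralizerGroup.diagPowMulEquiv (a : ℕ) : centralizerGroup A ≃* centralizerGroup (A.powSucc a) :=
  MulEquiv.ofBijective (centralizerGroup.diagPowHom A a)
    ⟨centralizerGroup.diagPowHom_injective a, fun U ↦ by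
      obtain ⟨u, hu, h⟩ := exists_eq_diagPow_of_mem_centralizerGroup a
        (U : complexBetti (A.powSucc a).X 1 ≃ₗ[ℂ] complexBetti (A.powSucc a).X 1) U.2
      exact ⟨⟨u, hu⟩, Subtype.ext h⟩⟩

variable {A}

/-- The underlying automorphism of `diagPowMulEquiv a u` is `u^{⊕(a+1)}`. [cite: Milne1999LefschetzClasses, §1 p. 643] -/
theorem centralizerGroup.coe_diagPowMulEquiv (a : ℕ) (u : centralizerGroup A) :
    (centralizerGroup.diagPowMulEquiv A a u : complexBetti (A.powSucc a).X 1 ≃ₗ[ℂ] complexBetti (A.powSucc a).X 1) =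
      diagPow A (u : complexBetti A.X 1 ≃ₗ[ℂ] complexBetti A.X 1) a :=
  rfl

end Centralizer

/-! ### §5 "as `k`-algebras with involution": `S(A) → S(A^{a+1})` and `G(A) → G(A^{a+1})` for `D = Σᵢ A × ⋯ × Dᵢ × ⋯ × A` -/

section Polarization

variable {A : AbelianVariety ℂ} {u : complexBetti A.X 1 ≃ₗ[ℂ] complexBetti A.X 1} {h : complexBetti A.X 2}

/-- **The diagonal action carries the multiplier along**: if `u ∈ C(A)` multiplies `Q_h` by `c`, then
`u^{⊕(a+1)}` multiplies `Q_{Σ prᵢ^* h}` on `A^{a+1}` by the same `c` (`0 < dim A`) — Milne §1 p. 643: "the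
involution [`D`] defines on `C(A)` is the restriction of the product of the involutions on the `C(Aᵢ)`
defined by the `Dᵢ`" (the block form of `Q_D`, `polarizationPairingOne_prod_apply_apply_eq_smul`), whence
`γ†γ` is unchanged under the diagonal embedding. [cite: Milne1999LefschetzClasses, §1 p. 643 and §4 p. 659] -/
theorem polarizationPairingOne_diagPow_eq_smul (hA0 : 0 < A.dim) (hu : u ∈ centralizerGroup A) (c : ℂ)
    (hc : ∀ x y : complexBetti A.X 1, polarizationPairingOne A.X h (A.dim - 1) (u x) (u y) =
      c • polarizationPairingOne A.X h (A.dim - 1) x y) : ∀ (a : ℕ) (x y : complexBetti (A.powSucc a).X 1),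
    polarizationPairingOne (A.powSucc a).X (powPolarizationClass A h a) ((A.powSucc a).dim - 1)
        (diagPow A u a x) (diagPow A u a y) =
      c • polarizationPairingOne (A.powSucc a).X (powPolarizationClass A h a) ((A.powSucc a).dim - 1) x y
  | 0 => hc
  | a + 1 => by
    intro x y
    -- `A^{a+2} = A^{a+1} × A`, `h^{(a+2)} = pr^* h^{(a+1)} + pr_A^* h`, `u^{⊕(a+2)} = u^{⊕(a+1)} ⊕ u` (by `rfl`)
    show polarizationPairingOne ((A.powSucc a).prod A).X
        (prodPolarizationClass (A.powSucc a) A (powPolarizationClass A h a) h) (((A.powSucc a).prod A).dim - 1)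
        (prodBlockDiagEquiv (diagPow A u a) u x) (prodBlockDiagEquiv (diagPow A u a) u y) =
      c • polarizationPairingOne ((A.powSucc a).prod A).X
        (prodPolarizationClass (A.powSucc a) A (powPolarizationClass A h a) h) (((A.powSucc a).prod A).dim - 1) x y
    have hmem : prodBlockDiagEquiv (diagPow A u a) u ∈ centralizerGroup ((A.powSucc a).prod A) :=
      diagPow_mem_centralizerGroup hu (a + 1)
    refine polarizationPairingOne_prod_apply_apply_eq_smul (powPolarizationClass A h a) h
      (dim_powSucc_pos hA0 a) hA0 hmem c (fun p p' ↦ ?_) (fun b b' ↦ ?_) x y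
    · rw [prodRestrictFst_prodBlockDiagEquiv_apply, prodRestrictFst_prodBlockDiagEquiv_apply]
      exact polarizationPairingOne_diagPow_eq_smul hA0 hu c hc a p p'
    · rw [prodRestrictSnd_prodBlockDiagEquiv_apply, prodRestrictSnd_prodBlockDiagEquiv_apply]
      exact hc b b'

/-- **`S(A)(ℂ) → S(A^{a+1})(ℂ)`, `u ↦ u^{⊕(a+1)}`**: for `0 < dim A` and `u ∈ unitaryCentralizerGroup A h`
(`u` commutes with `End(A)` and preserves `Q_h`), `u^{⊕(a+1)}` commutes with `End(A^{a+1})` and preserves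
`Q_{Σ prᵢ^* h}` — Milne §1 pp. 643–644 ("as `k`-algebras with involution"; `S(A) = {γ ∈ C(A) | γ†γ = 1}`)
and §4 p. 659 (the diagonal `γ ∈ G(A)` acting on `A^r`). [cite: Milne1999LefschetzClasses, §1 pp. 643–644 and §4 p. 659] -/
theorem diagPow_mem_unitaryCentralizerGroup (hA0 : 0 < A.dim) (hu : u ∈ unitaryCentralizerGroup A h) (a : ℕ) :
    diagPow A u a ∈ unitaryCentralizerGroup (A.powSucc a) (powPolarizationClass A h a) := by
  refine ⟨diagPow_mem_centralizerGroup hu.1 a, fun x y ↦ ?_⟩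
  have e := polarizationPairingOne_diagPow_eq_smul hA0 hu.1 1 (fun x y ↦ by rw [one_smul]; exact hu.2 x y) a x y
  rwa [one_smul] at e

/-- **`G(A)(ℂ) → G(A^{a+1})(ℂ)`, `u ↦ u^{⊕(a+1)}`, with the same multiplier `γ†γ`** (`0 < dim A`).
[cite: Milne1999LefschetzClasses, §1 p. 643 and §4 p. 659] -/
theorem diagPow_mem_similitudeCentralizerGroup (hA0 : 0 < A.dim) (hu : u ∈ similitudeCentralizerGroup A h)
    (a : ℕ) : diagPow A u a ∈ similitudeCentralizerGroup (A.powSucc a) (powPolarizationClass A h a) := by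
  obtain ⟨hu₁, c, hc⟩ := hu
  exact ⟨diagPow_mem_centralizerGroup hu₁ a, c, polarizationPairingOne_diagPow_eq_smul hA0 hu₁ c hc a⟩

variable (A h)

/-- **The diagonal embedding `S(A)(ℂ) → S(A^{a+1})(ℂ)` as a group homomorphism** (`0 < dim A`).
[cite: Milne1999LefschetzClasses, §1 pp. 643–644] -/
def unitaryCentralizerGroup.diagPowHom (hA0 : 0 < A.dim) (a : ℕ) :
    unitaryCentralizerGroup A h →* unitaryCentralizerGroup (A.powSucc a) (powPolarizationClass A h a) where
  toFun u := ⟨diagPow A (u : complexBetti A.X 1 ≃ₗ[ℂ] complexBetti A.X 1) a,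
    diagPow_mem_unitaryCentralizerGroup hA0 u.2 a⟩
  map_one' := Subtype.ext (diagPow_one a)
  map_mul' _ _ := Subtype.ext (diagPow_mul _ _ a)

variable {A h}

/-- The underlying automorphism of `unitaryCentralizerGroup.diagPowHom … u` is `u^{⊕(a+1)}`.
[cite: Milne1999LefschetzClasses, §1 pp. 643–644] -/
theorem unitaryCentralizerGroup.coe_diagPowHom (hA0 : 0 < A.dim) (a : ℕ) (u : unitaryCentralizerGroup A h) :
    (unitaryCentralizerGroup.diagPowHom A h hA0 a u :
        complexBetti (A.powSucc a).X 1 ≃ₗ[ℂ] complexBetti (A.powSucc a).X 1) =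
      diagPow A (u : complexBetti A.X 1 ≃ₗ[ℂ] complexBetti A.X 1) a :=
  rfl

/-- `unitaryCentralizerGroup.diagPowHom` is injective. [cite: Milne1999LefschetzClasses, §1 pp. 643–644] -/
theorem unitaryCentralizerGroup.diagPowHom_injective (hA0 : 0 < A.dim) (a : ℕ) :
    Function.Injective (unitaryCentralizerGroup.diagPowHom A h hA0 a) :=
  fun _ _ huv ↦ Subtype.ext (diagPow_injective a (congrArg Subtype.val huv))

end Polarization

end Literature.AlgebraicGeometry.Milne1999

end
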